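import Literature.MathematicalPhysics.QuantumFieldTheory.ConformalBootstrap3D.PointKernelK34v2Data
import Literature.MathematicalPhysics.QuantumFieldTheory.ConformalBootstrap3D.PointKernelParts

/-!
# K34v2 certificate, kernel part file P69: one-cell head segments 178, 179 in level ranges

The head cells whose kernel evaluation exceeds one `decide` are one-cell segments of `hsegsK34v2`; each is
checked by `PCert.hPartSideOK` (side conditions) and `PCert.hPartOK` per level range `[n_lo, n_lo + count)`
against an integer claim, the claims summing to `≥ 0` (`PointKernel.partsOK`); soundness is
`PCert.hParts_sound` (`PointKernelParts`).  The part files `P1, P2, …` are mutually independent (each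
imports only the data file); the ranges of one cell may span several of them, and the per-cell
conclusions `hparts_i` / `hcell_i` of those cells are assembled in `PointKernelK34v2.lean`.
Estimated kernel time 216 s.
-/

set_option maxRecDepth 100000
set_option maxHeartbeats 0

namespace Literature.MathematicalPhysics.QuantumFieldTheory.ConformalBootstrap3D.PointKernelK34v2

open Literature.MathematicalPhysics.QuantumFieldTheory.ConformalBootstrap3D.PointKernel

/-- levels `[0, 31)` of segment 178: partial lower sum `≥` claim. [folklore] -/
theorem part_178_0 : certK34v2.hPartOK (PCert.segAt hsegsK34v2 178) JHK34v2 0 31 (-18079389955388283166792122458115229810) = true := by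
  decide +kernel

/-- levels `[31, 44)` of segment 178: partial lower sum `≥` claim. [folklore] -/
theorem part_178_1 : certK34v2.hPartOK (PCert.segAt hsegsK34v2 178) JHK34v2 31 13 (16164197525978484852509091690357869398) = true := by
  decide +kernel

/-- levels `[44, 49)` of segment 178: partial lower sum `≥` claim. [folklore] -/
theorem part_178_2 : certK34v2.hPartOK (PCert.segAt hsegsK34v2 178) JHK34v2 44 5 (1915192429409798314283030767757360413) = true := by
  decide +kernel

/-- one-cell segment 179 (row 6, cell `[905/128, 453/64]`, chord, `n_F = 48`,
3 level ranges): side conditions. [folklore] -/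
theorem pside_179 : certK34v2.hPartSideOK (PCert.segAt hsegsK34v2 179) JHK34v2 = true := by
  decide +kernel

/-- its level ranges `(n_lo, count, claim)`. [folklore] -/
def parts_179 : List (ℕ × ℕ × ℤ) := [(0, 31, -16708524549751153894193837688698985353), (31, 13, 15515218195539103852069852524557315552), (44, 5, 1193306354212050042123985164141669802)]

/-- the ranges tile `[0, n_F]` and the claims sum to `≥ 0`. [folklore] -/
theorem pcov_179 : PointKernel.partsOK 48 parts_179 = true := by
  decide +kernel

/-- levels `[0, 31)` of segment 179: partial lower sum `≥` claim. [folklore] -/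
theorem part_179_0 : certK34v2.hPartOK (PCert.segAt hsegsK34v2 179) JHK34v2 0 31 (-16708524549751153894193837688698985353) = true := by
  decide +kernel

end Literature.MathematicalPhysics.QuantumFieldTheory.ConformalBootstrap3D.PointKernelK34v2
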